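import Summits.NavierStokesRegularity.NavierStokesRegularity.Theorems.WakeRatchetEternalViscousRate.Negative.EternalViscousRateFalseOfFineFixedSeedTodaPumps
import Summits.NavierStokesRegularity.NavierStokesRegularity.Theorems.WakeRatchetEternalViscousRate.Negative.EternalViscousRateFalseOfViscousBlockDSSWaves

/-!
# The explicit construction item `FineFixedSeedTodaPumps` IMPLIES the abstract one `ViscousBlockDSSWaves`
# (route WakeRatchet, stmt-NavierStokesRegularity-25647 / -25584; edge between two construction items)

Several items of the routes `WakeRatchet` / `TaoLadderRungTwoBreak` are held modulo the ABSTRACT construction item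
`WakeRatchetViscDSS.ViscousBlockDSSWaves` (p608789: on some fixed class `E₂(R)`, at arbitrarily small scale ratios, a non-trivial
uniformly bounded block-self-similar admissible eternal solution with positive covariant viscosity).  The session's EXPLICIT item
`WakeRatchetCircuitPumpNoUniform.FineFixedSeedTodaPumps` (p829025: exactly self-similar Type-I non-trivial solutions of the m = 2
seeded graded Toda circuit `T_ε` at ONE fixed seed `ε ∈ (0,1]` and arbitrarily fine scale ratios — the fixed-seed continuation
`lam ↓ 1` of the PROVED perpetual pump, stmt-1834) implies it:

* `viscousBlockDSSWaves_of_fineFixedSeedTodaPumps : FineFixedSeedTodaPumps → ViscousBlockDSSWaves`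

(pad the pump to `Fin 4` — `…CircuitPumpPad/PadClass/TodaClass`: the padded pulled-back table is the Toda member of `E₂(2/ε)` —
and renormalise with `WakeRatchetCircuitPumpAssembly.viscousBlockDSS_of_pumpWitness`: covariant viscosity `ν̂ = 1`, shell period
`p = 1`, lag `2 log(1+ε₀)`, scale ratio `ε₀ = lam^{2/5} − 1 < ε'` once `lam < (1+ε')^{5/2}`).  So ONE concrete two-mode ODE continuation
problem discharges every hold filed modulo `ViscousBlockDSSWaves`.  Neither item is constructed here; no verdict changes.
HONEST FRAMING: MODEL lattice ODEs only (Tao 2016 §4, §6.4); nothing here is a statement about the Navier–Stokes equations.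
-/

set_option linter.dupNamespace false

noncomputable section

open scoped BigOperators
open Set Real Filter Topology MeasureTheory

namespace Summit.NavierStokesRegularity.NavierStokesRegularity.Theorems.WakeRatchetCircuitPumpNoUniform

open Summit.NavierStokesRegularity.NavierStokesRegularity.Theorems.CircuitPumpNegative
open Summit.NavierStokesRegularity.NavierStokesRegularity.Theorems.PerpetualPumpCircuitPump
open Summit.NavierStokesRegularity.NavierStokesRegularity.Theorems.WakeRatchetCircuitPumpBdd
open Summit.NavierStokesRegularity.NavierStokesRegularity.Theorems.WakeRatchetCircuitPumpTable
open Summit.NavierStokesRegularity.NavierStokesRegularity.Theorems.WakeRatchetCircuitPumpAssembly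
open Summit.NavierStokesRegularity.NavierStokesRegularity.Theorems.WakeRatchetCircuitPumpAction
open Summit.NavierStokesRegularity.NavierStokesRegularity.Theorems.WakeRatchetCircuitPumpKill
open Summit.NavierStokesRegularity.NavierStokesRegularity.Theorems.WakeRatchetCircuitPumpPad
open Summit.NavierStokesRegularity.NavierStokesRegularity.Theorems.WakeRatchetCircuitPumpPadClass
open Summit.NavierStokesRegularity.NavierStokesRegularity.Theorems.WakeRatchetCircuitPumpTodaClass
open Summit.NavierStokesRegularity.NavierStokesRegularity.Theorems.WakeRatchetViscDSS
open Literature.Analysis.FluidPDE Literature.Analysis.FluidPDE.TaoCascade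

/-- **One fixed-seed Toda pump at scale ratio `lam` is a viscous block-DSS wave on `E₂(2/ε)` at scale ratio `ε₀ = lam^{2/5} − 1`**
(covariant viscosity `1`, shell period `1`, lag `2 log(1+ε₀)`).  MODEL lattice only.
[cite: Tao2016AveragedNS, §4 Thm. 4.2 (statement shape), the viscous equation before it, §6.4; cell vocabulary (stmt-NavierStokesRegularity-25647)] -/
theorem viscBlockDSS_of_todaPump {lam ε : ℝ} (hlam : 1 < lam) (hε : 0 < ε) (hε1 : ε ≤ 1)
    (X : Fin 2 → ℤ → ℝ → ℝ) (hode : SolvesODE lam (fun (i₁ i₂ i₃ : Fin 2) (μ : Option (Fin 3)) => if μ = none then (if i₁ = 1 ∧ i₂ = 1 ∧ i₃ = 0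
                then (-1 : ℝ) else if i₁ = 1 ∧ i₂ = 0 ∧ i₃ = 1 then 1 / 2 else if i₁ = 0 ∧ i₂ = 1 ∧ i₃ = 1
                then 1 / 2 else if i₁ = 0 ∧ i₂ = 0 ∧ i₃ = 1 then ε else if i₁ = 0 ∧ i₂ = 1 ∧ i₃ = 0 then -ε /
                2 else if i₁ = 1 ∧ i₂ = 0 ∧ i₃ = 0 then -ε / 2 else 0) else if μ = some 2 then (if i₁ = 1 ∧
                i₂ = 1 ∧ i₃ = 0 then 1 else 0) else if μ = some 1 then (if i₁ = 1 ∧ i₂ = 0 ∧ i₃ = 1 then -1 /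
                2 else 0) else (if i₁ = 0 ∧ i₂ = 1 ∧ i₃ = 1 then -1 / 2 else 0)) X) (hdss : IsDSS lam 1 X) (hTI : IsTypeI lam X)
    (hnt : IsNontrivial X) :
    ∃ ε₀ : ℝ, 0 < ε₀ ∧ (1 + ε₀) ^ ((5 : ℝ) / 2) = lam ∧
      ∃ α : Fin 4 → Fin 4 → Fin 4 → ℤ × ℤ × ℤ → ℝ, InTableClass (2 / ε) α ∧
        ∃ W : ℤ → ℝ → Em 4, IsEternalVisc ε₀ 1 α W ∧ UniformBound W ∧
          (∀ (n : ℤ) (σ : ℝ), W (n + 1) σ = W n (σ - 2 * Real.log (1 + ε₀))) ∧ ∃ n σ, W n σ ≠ 0 := by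
  have hbd := shellBound_of_typeI hlam _ X hode hTI
  -- pad to four modes
  have hode₄ := solvesODE_pad (k := 2) hode
  have hdss₄ := isDSS_pad (k := 2) hdss
  have hTI₄ := isTypeI_pad (k := 2) hlam hTI
  have hnt₄ := isNontrivial_pad (k := 2) hnt
  have hbd₄ : ∀ n : ℤ, ∃ P : ℝ, ∀ t : ℝ, -(1 / 2) ≤ t → t < 0 →
      ‖shellVec (Fin.append X (fun (_ : Fin 2) (_ : ℤ) (_ : ℝ) => (0 : ℝ))) n t‖ ≤ P := by
    intro n
    obtain ⟨P, hP⟩ := hbd n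
    exact ⟨P, fun t h1 h2 => by rw [norm_shellVec_pad]; exact hP t h1 h2⟩
  -- the padded pulled-back table is the padding of the m = 2 Toda member of `E₂(2/ε)`
  have h2 : InTableClass (2 / ε) (fun (i₁ i₂ i₃ : Fin 2) (μ : ℤ × ℤ × ℤ) =>
            if μ = (0, 0, 0) then (fun (i₁ i₂ i₃ : Fin 2) (μ : Option (Fin 3)) => if μ = none then (if i₁ = 1 ∧ i₂ = 1 ∧ i₃ = 0
              then (-1 : ℝ) else if i₁ = 1 ∧ i₂ = 0 ∧ i₃ = 1 then 1 / 2 else if i₁ = 0 ∧ i₂ = 1 ∧ i₃ = 1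
              then 1 / 2 else if i₁ = 0 ∧ i₂ = 0 ∧ i₃ = 1 then ε else if i₁ = 0 ∧ i₂ = 1 ∧ i₃ = 0 then -ε /
              2 else if i₁ = 1 ∧ i₂ = 0 ∧ i₃ = 0 then -ε / 2 else 0) else if μ = some 2 then (if i₁ = 1 ∧
              i₂ = 1 ∧ i₃ = 0 then 1 else 0) else if μ = some 1 then (if i₁ = 1 ∧ i₂ = 0 ∧ i₃ = 1 then -1 /
              2 else 0) else (if i₁ = 0 ∧ i₂ = 1 ∧ i₃ = 1 then -1 / 2 else 0)) i₁ i₂ i₃ none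
            else if μ = (1, 0, 0) then (fun (i₁ i₂ i₃ : Fin 2) (μ : Option (Fin 3)) => if μ = none then (if i₁ = 1 ∧ i₂ = 1 ∧ i₃ = 0
              then (-1 : ℝ) else if i₁ = 1 ∧ i₂ = 0 ∧ i₃ = 1 then 1 / 2 else if i₁ = 0 ∧ i₂ = 1 ∧ i₃ = 1
              then 1 / 2 else if i₁ = 0 ∧ i₂ = 0 ∧ i₃ = 1 then ε else if i₁ = 0 ∧ i₂ = 1 ∧ i₃ = 0 then -ε /
              2 else if i₁ = 1 ∧ i₂ = 0 ∧ i₃ = 0 then -ε / 2 else 0) else if μ = some 2 then (if i₁ = 1 ∧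
              i₂ = 1 ∧ i₃ = 0 then 1 else 0) else if μ = some 1 then (if i₁ = 1 ∧ i₂ = 0 ∧ i₃ = 1 then -1 /
              2 else 0) else (if i₁ = 0 ∧ i₂ = 1 ∧ i₃ = 1 then -1 / 2 else 0)) i₁ i₂ i₃ (some 0)
            else if μ = (0, 1, 0) then (fun (i₁ i₂ i₃ : Fin 2) (μ : Option (Fin 3)) => if μ = none then (if i₁ = 1 ∧ i₂ = 1 ∧ i₃ = 0
              then (-1 : ℝ) else if i₁ = 1 ∧ i₂ = 0 ∧ i₃ = 1 then 1 / 2 else if i₁ = 0 ∧ i₂ = 1 ∧ i₃ = 1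
              then 1 / 2 else if i₁ = 0 ∧ i₂ = 0 ∧ i₃ = 1 then ε else if i₁ = 0 ∧ i₂ = 1 ∧ i₃ = 0 then -ε /
              2 else if i₁ = 1 ∧ i₂ = 0 ∧ i₃ = 0 then -ε / 2 else 0) else if μ = some 2 then (if i₁ = 1 ∧
              i₂ = 1 ∧ i₃ = 0 then 1 else 0) else if μ = some 1 then (if i₁ = 1 ∧ i₂ = 0 ∧ i₃ = 1 then -1 /
              2 else 0) else (if i₁ = 0 ∧ i₂ = 1 ∧ i₃ = 1 then -1 / 2 else 0)) i₁ i₂ i₃ (some 1)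
            else if μ = (0, 0, 1) then (fun (i₁ i₂ i₃ : Fin 2) (μ : Option (Fin 3)) => if μ = none then (if i₁ = 1 ∧ i₂ = 1 ∧ i₃ = 0
              then (-1 : ℝ) else if i₁ = 1 ∧ i₂ = 0 ∧ i₃ = 1 then 1 / 2 else if i₁ = 0 ∧ i₂ = 1 ∧ i₃ = 1
              then 1 / 2 else if i₁ = 0 ∧ i₂ = 0 ∧ i₃ = 1 then ε else if i₁ = 0 ∧ i₂ = 1 ∧ i₃ = 0 then -ε /
              2 else if i₁ = 1 ∧ i₂ = 0 ∧ i₃ = 0 then -ε / 2 else 0) else if μ = some 2 then (if i₁ = 1 ∧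
              i₂ = 1 ∧ i₃ = 0 then 1 else 0) else if μ = some 1 then (if i₁ = 1 ∧ i₂ = 0 ∧ i₃ = 1 then -1 /
              2 else 0) else (if i₁ = 0 ∧ i₂ = 1 ∧ i₃ = 1 then -1 / 2 else 0)) i₁ i₂ i₃ (some 2) else 0) := by
    rw [toda_pullback_eq ε]
    exact todaTable_inTableClass ε hε hε1
  have hclass : InTableClass (2 / ε) (fun (j₁ j₂ j₃ : Fin (2 + 2)) (μ : ℤ × ℤ × ℤ) =>
            if μ = (0, 0, 0) then (Fin.append (fun i₁ : Fin 2 => Fin.append (fun i₂ : Fin 2 => Fin.append ((fun (i₁ i₂ i₃ : Fin 2) (μ : Option (Fin 3)) => if μ = none then (if i₁ = 1 ∧ i₂ = 1 ∧ i₃ = 0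
              then (-1 : ℝ) else if i₁ = 1 ∧ i₂ = 0 ∧ i₃ = 1 then 1 / 2 else if i₁ = 0 ∧ i₂ = 1 ∧ i₃ = 1
              then 1 / 2 else if i₁ = 0 ∧ i₂ = 0 ∧ i₃ = 1 then ε else if i₁ = 0 ∧ i₂ = 1 ∧ i₃ = 0 then -ε /
              2 else if i₁ = 1 ∧ i₂ = 0 ∧ i₃ = 0 then -ε / 2 else 0) else if μ = some 2 then (if i₁ = 1 ∧
              i₂ = 1 ∧ i₃ = 0 then 1 else 0) else if μ = some 1 then (if i₁ = 1 ∧ i₂ = 0 ∧ i₃ = 1 then -1 /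
              2 else 0) else (if i₁ = 0 ∧ i₂ = 1 ∧ i₃ = 1 then -1 / 2 else 0)) i₁ i₂)
              (fun (_ : Fin 2) (_ : Option (Fin 3)) => (0 : ℝ)))
            (fun (_ : Fin 2) (_ : Fin (2 + 2)) (_ : Option (Fin 3)) => (0 : ℝ)))
            (fun (_ : Fin 2) (_ : Fin (2 + 2)) (_ : Fin (2 + 2)) (_ : Option (Fin 3)) => (0 : ℝ))) j₁ j₂ j₃ none
            else if μ = (1, 0, 0) then (Fin.append (fun i₁ : Fin 2 => Fin.append (fun i₂ : Fin 2 => Fin.append ((fun (i₁ i₂ i₃ : Fin 2) (μ : Option (Fin 3)) => if μ = none then (if i₁ = 1 ∧ i₂ = 1 ∧ i₃ = 0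
              then (-1 : ℝ) else if i₁ = 1 ∧ i₂ = 0 ∧ i₃ = 1 then 1 / 2 else if i₁ = 0 ∧ i₂ = 1 ∧ i₃ = 1
              then 1 / 2 else if i₁ = 0 ∧ i₂ = 0 ∧ i₃ = 1 then ε else if i₁ = 0 ∧ i₂ = 1 ∧ i₃ = 0 then -ε /
              2 else if i₁ = 1 ∧ i₂ = 0 ∧ i₃ = 0 then -ε / 2 else 0) else if μ = some 2 then (if i₁ = 1 ∧
              i₂ = 1 ∧ i₃ = 0 then 1 else 0) else if μ = some 1 then (if i₁ = 1 ∧ i₂ = 0 ∧ i₃ = 1 then -1 /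
              2 else 0) else (if i₁ = 0 ∧ i₂ = 1 ∧ i₃ = 1 then -1 / 2 else 0)) i₁ i₂)
              (fun (_ : Fin 2) (_ : Option (Fin 3)) => (0 : ℝ)))
            (fun (_ : Fin 2) (_ : Fin (2 + 2)) (_ : Option (Fin 3)) => (0 : ℝ)))
            (fun (_ : Fin 2) (_ : Fin (2 + 2)) (_ : Fin (2 + 2)) (_ : Option (Fin 3)) => (0 : ℝ))) j₁ j₂ j₃ (some 0)
            else if μ = (0, 1, 0) then (Fin.append (fun i₁ : Fin 2 => Fin.append (fun i₂ : Fin 2 => Fin.append ((fun (i₁ i₂ i₃ : Fin 2) (μ : Option (Fin 3)) => if μ = none then (if i₁ = 1 ∧ i₂ = 1 ∧ i₃ = 0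
              then (-1 : ℝ) else if i₁ = 1 ∧ i₂ = 0 ∧ i₃ = 1 then 1 / 2 else if i₁ = 0 ∧ i₂ = 1 ∧ i₃ = 1
              then 1 / 2 else if i₁ = 0 ∧ i₂ = 0 ∧ i₃ = 1 then ε else if i₁ = 0 ∧ i₂ = 1 ∧ i₃ = 0 then -ε /
              2 else if i₁ = 1 ∧ i₂ = 0 ∧ i₃ = 0 then -ε / 2 else 0) else if μ = some 2 then (if i₁ = 1 ∧
              i₂ = 1 ∧ i₃ = 0 then 1 else 0) else if μ = some 1 then (if i₁ = 1 ∧ i₂ = 0 ∧ i₃ = 1 then -1 /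
              2 else 0) else (if i₁ = 0 ∧ i₂ = 1 ∧ i₃ = 1 then -1 / 2 else 0)) i₁ i₂)
              (fun (_ : Fin 2) (_ : Option (Fin 3)) => (0 : ℝ)))
            (fun (_ : Fin 2) (_ : Fin (2 + 2)) (_ : Option (Fin 3)) => (0 : ℝ)))
            (fun (_ : Fin 2) (_ : Fin (2 + 2)) (_ : Fin (2 + 2)) (_ : Option (Fin 3)) => (0 : ℝ))) j₁ j₂ j₃ (some 1)
            else if μ = (0, 0, 1) then (Fin.append (fun i₁ : Fin 2 => Fin.append (fun i₂ : Fin 2 => Fin.append ((fun (i₁ i₂ i₃ : Fin 2) (μ : Option (Fin 3)) => if μ = none then (if i₁ = 1 ∧ i₂ = 1 ∧ i₃ = 0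
              then (-1 : ℝ) else if i₁ = 1 ∧ i₂ = 0 ∧ i₃ = 1 then 1 / 2 else if i₁ = 0 ∧ i₂ = 1 ∧ i₃ = 1
              then 1 / 2 else if i₁ = 0 ∧ i₂ = 0 ∧ i₃ = 1 then ε else if i₁ = 0 ∧ i₂ = 1 ∧ i₃ = 0 then -ε /
              2 else if i₁ = 1 ∧ i₂ = 0 ∧ i₃ = 0 then -ε / 2 else 0) else if μ = some 2 then (if i₁ = 1 ∧
              i₂ = 1 ∧ i₃ = 0 then 1 else 0) else if μ = some 1 then (if i₁ = 1 ∧ i₂ = 0 ∧ i₃ = 1 then -1 /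
              2 else 0) else (if i₁ = 0 ∧ i₂ = 1 ∧ i₃ = 1 then -1 / 2 else 0)) i₁ i₂)
              (fun (_ : Fin 2) (_ : Option (Fin 3)) => (0 : ℝ)))
            (fun (_ : Fin 2) (_ : Fin (2 + 2)) (_ : Option (Fin 3)) => (0 : ℝ)))
            (fun (_ : Fin 2) (_ : Fin (2 + 2)) (_ : Fin (2 + 2)) (_ : Option (Fin 3)) => (0 : ℝ))) j₁ j₂ j₃ (some 2) else 0) := by
    rw [pullback_pad_comm]
    exact inTableClass_pad (k := 2) h2
  obtain ⟨M, hact⟩ := action_of_typeI hlam _ _ hode₄ hTI₄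
  obtain ⟨ε₀, W, hε₀, hlamε, hW, hU, hD, hne⟩ :=
    viscousBlockDSS_of_pumpWitness hlam _ _ hode₄ hdss₄ hTI₄ hnt₄ hact hbd₄
  exact ⟨ε₀, hε₀, hlamε, _, hclass, W, hW, hU, hD, hne⟩

/-- **`FineFixedSeedTodaPumps → ViscousBlockDSSWaves`.**  The explicit construction item of ⟨25647⟩'s fixed-seed negative lemma
implies the abstract one of p608789: at the spread `R = 2/ε` of the fixed seed, for every `ε' > 0` take `lam₁ = (1+ε')^{5/2}`, a
pump at some `lam ∈ (1, lam₁)`, and its renormalisation (`viscBlockDSS_of_todaPump`), whose scale ratio satisfies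
`(1+ε₀)^{5/2} = lam < (1+ε')^{5/2}`, i.e. `ε₀ < ε'`.  MODEL lattice only; neither item is constructed.
[cite: Tao2016AveragedNS, §4 Thm. 4.2 (statement shape), the viscous equation before it, §6.4; cell vocabulary (stmt-NavierStokesRegularity-25647)] -/
theorem viscousBlockDSSWaves_of_fineFixedSeedTodaPumps : FineFixedSeedTodaPumps → ViscousBlockDSSWaves := by
  rintro ⟨ε, hε, hε1, H⟩
  have hR : (1 : ℝ) ≤ 2 / ε := by
    rw [le_div_iff₀ hε]; linarith
  refine ⟨2 / ε, hR, fun ε' hε' => ?_⟩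
  have hlam₁ : (1 : ℝ) < (1 + ε') ^ ((5 : ℝ) / 2) := Real.one_lt_rpow (by linarith) (by norm_num)
  obtain ⟨lam, hlam, hlt, X, hode, hdss, hTI, hnt⟩ := H _ hlam₁
  obtain ⟨ε₀, hε₀, hlamε, α, hα, W, hW, hU, hD, hne⟩ := viscBlockDSS_of_todaPump hlam hε hε1 X hode hdss hTI hnt
  have hε₀le : ε₀ ≤ ε' := by
    by_contra hcon
    have h1 : (1 + ε') ^ ((5 : ℝ) / 2) ≤ (1 + ε₀) ^ ((5 : ℝ) / 2) :=
      Real.rpow_le_rpow (by linarith) (by linarith) (by norm_num)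
    rw [hlamε] at h1
    linarith
  refine ⟨ε₀, hε₀, hε₀le, α, hα, 1, W, 1, 2 * Real.log (1 + ε₀), one_pos, one_pos, hW, hU, ?_, hne⟩
  intro n σ
  simpa using hD n σ

end Summit.NavierStokesRegularity.NavierStokesRegularity.Theorems.WakeRatchetCircuitPumpNoUniform

end
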